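import Mathlib
import Literature.Algebra.Polynomial.CoeffList
import Literature.Algebra.Polynomial.CoeffListBivariate
import Literature.Algebra.Polynomial.CoeffListPositivity
import Summits.KontsevichZagierPeriods.KontsevichZagierPeriods.Theorems.IsogenyCertificatesJLPairData
import HarnessLib

/-!
# The Jacquet–Langlands correspondence for `X_0^{35}`: the algebraic identities

Support file for `JLPairIdentityX` (stmt-KontsevichZagierPeriods-14655) and `JLPairIdentityOne`
(stmt-14654), route IsogenyCertificates; data in `IsogenyCertificatesJLPairData.lean`. On the
correspondence `Z : Q(u) x² − P₁(u) x + P₂(u) = 0`, `E(u) y = (N₁(u) x + N₀(u)) w` between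
`C : w² = f_C(u)` and `X : y² = f_X(x)` we PROVE, by kernel-checked coefficient-list certificates
(`Literature.Algebra.Polynomial.CoeffList`, `CoeffList₂`; `decide +kernel`, about one minute in all):

* `onCurve`: `E² f_X(x) = (N₁x + N₀)² f_C(u)` for every root `x` (both points of `Z` over `(u, w)`
  lie on `X` with `y = (N₁x+N₀)w/E`) — a bivariate identity of degree `166` in `u`;
* `trace_row1`, `trace_row2`: for the two roots `x_± = (P₁ ± s)/(2Q)`, `s² = disc = P₁² − 4QP₂`,
  with the implicit derivatives `x_±' = (x_± D₁ − D₂)/(±Q s)` (`D₁ = P₁'Q − P₁Q'`,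
  `D₂ = P₂'Q − P₂Q'`): `Σ_± x_±' E/(N₁x_± + N₀) = −10 − 6u` and `Σ_± x_± x_±' E/(N₁x_± + N₀) = 4 + 2u`,
  i.e. `Σᵢ dxᵢ/yᵢ = (−10−6u) du/w` and `Σᵢ xᵢ dxᵢ/yᵢ = (4+2u) du/w` along `Z` — the tangent matrix
  `[[−10,−6],[4,2]]` of `φ_A`, the integrand identity of the items' rule-(1b) step;
* small evaluation lemmas (`E = Q²(u²+4)`, `disc`, `D₁`, `D₂`, `disc'`, a leading-order lower
  bound `Q − 36u¹⁸ > 0` on `(−∞,−1]`, and the values at `u = −1`).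

No analysis here (signs, branches and moves are in the companion files).
-/

namespace Summit.KontsevichZagierPeriods.IsogenyCertificates.JLPair

open Literature.Algebra.Polynomial

/-! ### Kernel certificates -/

/-- On-curve certificate: all coefficients of `Q⁵(E² f_X − f_C (N₀ + N₁x)²) − L·(P₂ − P₁x + Qx²)`
vanish. [evidence: stmt-KontsevichZagierPeriods-14655] -/
theorem onCurve_cert :
    CoeffList₂.isZero (CoeffList₂.sub
      (CoeffList₂.smul (CoeffList.pow cQ 5)
        (CoeffList₂.sub (CoeffList₂.smul (CoeffList.mul cE cE) cFX)
          (CoeffList₂.smul cFC (CoeffList₂.mul [cN0, cN1] [cN0, cN1]))))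
      (CoeffList₂.mul cL [cP2, CoeffList.neg cP1, cQ])) = true := by
  decide +kernel

/-- First trace certificate: `E (W₊M₋ − W₋M₊) − (−10−6u) Q s M₊M₋ = K₁ · (s² − disc)` coefficientwise.
[evidence: stmt-KontsevichZagierPeriods-14655] -/
theorem trace_row1_cert :
    CoeffList₂.isZero (CoeffList₂.sub
      (CoeffList₂.sub (CoeffList₂.smul cE (CoeffList₂.sub (CoeffList₂.mul cWp cMm) (CoeffList₂.mul cWm cMp)))
        (CoeffList₂.mul [[], CoeffList.mul cQ [-10, -6]] (CoeffList₂.mul cMp cMm)))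
      (CoeffList₂.mul cK1 [CoeffList.neg cD, [], [1]])) = true := by
  decide +kernel

/-- Second trace certificate: `E (X₊W₊M₋ − X₋W₋M₊) − 2(4+2u) Q² s M₊M₋ = K₂ · (s² − disc)`
coefficientwise. [evidence: stmt-KontsevichZagierPeriods-14655] -/
theorem trace_row2_cert :
    CoeffList₂.isZero (CoeffList₂.sub
      (CoeffList₂.sub
        (CoeffList₂.smul cE (CoeffList₂.sub (CoeffList₂.mul (CoeffList₂.mul cXp cWp) cMm)
          (CoeffList₂.mul (CoeffList₂.mul cXm cWm) cMp)))
        (CoeffList₂.mul [[], CoeffList.smul 2 (CoeffList.mul (CoeffList.mul cQ cQ) [4, 2])]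
          (CoeffList₂.mul cMp cMm)))
      (CoeffList₂.mul cK2 [CoeffList.neg cD, [], [1]])) = true := by
  decide +kernel

/-! ### The identities over `ℝ` -/

/-- **On the correspondence, both points lie on `X`**: if `Q(u) x² − P₁(u) x + P₂(u) = 0` and
`Q(u) ≠ 0` then `E(u)² f_X(x) = (N₁(u) x + N₀(u))² f_C(u)`. [evidence: stmt-14655 REPORT.md §3 (i)] -/
theorem onCurve (u x : ℝ) (hQ : CoeffList.eval u cQ ≠ 0)
    (hx : CoeffList.eval u cQ * x ^ 2 - CoeffList.eval u cP1 * x + CoeffList.eval u cP2 = 0) :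
    (CoeffList.eval u cE) ^ 2 * (-x * (9 * x + 4) * (4 * x + 1) * (172 * x ^ 3 + 176 * x ^ 2 + 60 * x + 7)) =
      (CoeffList.eval u cN1 * x + CoeffList.eval u cN0) ^ 2 *
        ((u ^ 2 + 4) * (u + 1) * (u ^ 3 - 5 * u ^ 2 + 3 * u - 19)) := by
  have h := CoeffList₂.eval_eq_zero_of_isZero u x _ onCurve_cert
  simp only [CoeffList₂.eval_sub, CoeffList₂.eval_smul, CoeffList₂.eval_mul, CoeffList₂.eval_cons,
    CoeffList₂.eval_nil, CoeffList.eval_pow, CoeffList.eval_mul, CoeffList.eval_neg, cFX, cFC,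
    CoeffList.eval_cons, CoeffList.eval_nil, mul_zero, add_zero] at h
  push_cast at h
  have hM : CoeffList.eval u cP2 + x * (-CoeffList.eval u cP1 + x * CoeffList.eval u cQ) = 0 := by
    linear_combination hx
  rw [hM, mul_zero, sub_zero] at h
  have hT := (mul_eq_zero.mp h).resolve_left (pow_ne_zero 5 hQ)
  linear_combination hT

/-- **The action on `dx/y`** (`φ_A^*(dx/y) = −10 du/w − 6 u du/w`): for the two roots
`x_± = (P₁ ± s)/(2Q)` of `Q x² − P₁ x + P₂` (`s² = disc ≠ 0`) with implicit derivatives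
`x_±' = (x_± D₁ − D₂)/(±Q s)`, `Σ_± x_±' E/(N₁ x_± + N₀) = −10 − 6u`.
[evidence: stmt-14655 REPORT.md §3 (ii), j = 1] -/
theorem trace_row1 (u s : ℝ)
    (hs : s ^ 2 = CoeffList.eval u cP1 ^ 2 - 4 * CoeffList.eval u cQ * CoeffList.eval u cP2)
    (hs0 : s ≠ 0) (hQ : CoeffList.eval u cQ ≠ 0)
    (hMp : CoeffList.eval u cN1 * ((CoeffList.eval u cP1 + s) / (2 * CoeffList.eval u cQ)) +
      CoeffList.eval u cN0 ≠ 0)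
    (hMm : CoeffList.eval u cN1 * ((CoeffList.eval u cP1 - s) / (2 * CoeffList.eval u cQ)) +
      CoeffList.eval u cN0 ≠ 0) :
    ((CoeffList.eval u cP1 + s) / (2 * CoeffList.eval u cQ) * CoeffList.eval u cD1 - CoeffList.eval u cD2) /
          (CoeffList.eval u cQ * s) * CoeffList.eval u cE /
        (CoeffList.eval u cN1 * ((CoeffList.eval u cP1 + s) / (2 * CoeffList.eval u cQ)) + CoeffList.eval u cN0) +
      ((CoeffList.eval u cP1 - s) / (2 * CoeffList.eval u cQ) * CoeffList.eval u cD1 - CoeffList.eval u cD2) /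
          (-(CoeffList.eval u cQ * s)) * CoeffList.eval u cE /
        (CoeffList.eval u cN1 * ((CoeffList.eval u cP1 - s) / (2 * CoeffList.eval u cQ)) + CoeffList.eval u cN0)
      = -10 - 6 * u := by
  have h := CoeffList₂.eval_eq_zero_of_isZero u s _ trace_row1_cert
  simp only [cWp, cWm, cMp, cMm, cXp, cXm, cD, CoeffList₂.eval_sub, CoeffList₂.eval_add,
    CoeffList₂.eval_smul, CoeffList₂.eval_mul, CoeffList₂.eval_cons, CoeffList₂.eval_nil,
    CoeffList.eval_sub, CoeffList.eval_mul, CoeffList.eval_smul, CoeffList.eval_neg,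
    CoeffList.eval_cons, CoeffList.eval_nil, mul_zero, add_zero, zero_add] at h
  push_cast at h
  set Q := CoeffList.eval u cQ with hQdef
  set P1 := CoeffList.eval u cP1
  set P2 := CoeffList.eval u cP2
  set D1 := CoeffList.eval u cD1
  set D2 := CoeffList.eval u cD2
  set E := CoeffList.eval u cE
  set N1 := CoeffList.eval u cN1
  set N0 := CoeffList.eval u cN0
  set K := CoeffList₂.eval u s cK1
  have hD : -(P1 * P1 - 4 * (Q * P2)) + s * (s * 1) = 0 := by linear_combination hs
  rw [hD, mul_zero, sub_zero] at h
  have h2Q : (2 : ℝ) * Q ≠ 0 := mul_ne_zero two_ne_zero hQ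
  have hMp' : N1 * (P1 + s) + 2 * Q * N0 ≠ 0 := by
    intro h0; apply hMp
    rw [show N1 * ((P1 + s) / (2 * Q)) + N0 = (N1 * (P1 + s) + 2 * Q * N0) / (2 * Q) by
      field_simp]
    rw [h0, zero_div]
  have hMm' : N1 * (P1 - s) + 2 * Q * N0 ≠ 0 := by
    intro h0; apply hMm
    rw [show N1 * ((P1 - s) / (2 * Q)) + N0 = (N1 * (P1 - s) + 2 * Q * N0) / (2 * Q) by
      field_simp]
    rw [h0, zero_div]
  have hQs : Q * s ≠ 0 := mul_ne_zero hQ hs0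
  have e1 : ((P1 + s) / (2 * Q) * D1 - D2) / (Q * s) * E / (N1 * ((P1 + s) / (2 * Q)) + N0) =
      (D1 * (P1 + s) - 2 * Q * D2) * E / (Q * s * (N1 * (P1 + s) + 2 * Q * N0)) := by
    rw [div_eq_div_iff hMp (mul_ne_zero hQs hMp')]
    field_simp
  have e2 : ((P1 - s) / (2 * Q) * D1 - D2) / (-(Q * s)) * E / (N1 * ((P1 - s) / (2 * Q)) + N0) =
      -((D1 * (P1 - s) - 2 * Q * D2) * E) / (Q * s * (N1 * (P1 - s) + 2 * Q * N0)) := by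
    rw [div_eq_div_iff hMm (mul_ne_zero hQs hMm')]
    field_simp
  rw [e1, e2, div_add_div _ _ (mul_ne_zero hQs hMp') (mul_ne_zero hQs hMm'),
    div_eq_iff (mul_ne_zero (mul_ne_zero hQs hMp') (mul_ne_zero hQs hMm'))]
  linear_combination (Q * s) * h

/-- **The action on `x dx/y`** (`φ_A^*(x dx/y) = 4 du/w + 2 u du/w`): with the notation of
`trace_row1`, `Σ_± x_± x_±' E/(N₁ x_± + N₀) = 4 + 2u`. This is the pointwise integrand identity
behind `JLPairIdentityX`. [evidence: stmt-14655 REPORT.md §3 (ii), j = 2] -/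
theorem trace_row2 (u s : ℝ)
    (hs : s ^ 2 = CoeffList.eval u cP1 ^ 2 - 4 * CoeffList.eval u cQ * CoeffList.eval u cP2)
    (hs0 : s ≠ 0) (hQ : CoeffList.eval u cQ ≠ 0)
    (hMp : CoeffList.eval u cN1 * ((CoeffList.eval u cP1 + s) / (2 * CoeffList.eval u cQ)) +
      CoeffList.eval u cN0 ≠ 0)
    (hMm : CoeffList.eval u cN1 * ((CoeffList.eval u cP1 - s) / (2 * CoeffList.eval u cQ)) +
      CoeffList.eval u cN0 ≠ 0) :
    (CoeffList.eval u cP1 + s) / (2 * CoeffList.eval u cQ) *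
        (((CoeffList.eval u cP1 + s) / (2 * CoeffList.eval u cQ) * CoeffList.eval u cD1 - CoeffList.eval u cD2) /
          (CoeffList.eval u cQ * s)) * CoeffList.eval u cE /
        (CoeffList.eval u cN1 * ((CoeffList.eval u cP1 + s) / (2 * CoeffList.eval u cQ)) + CoeffList.eval u cN0) +
      (CoeffList.eval u cP1 - s) / (2 * CoeffList.eval u cQ) *
        (((CoeffList.eval u cP1 - s) / (2 * CoeffList.eval u cQ) * CoeffList.eval u cD1 - CoeffList.eval u cD2) /
          (-(CoeffList.eval u cQ * s))) * CoeffList.eval u cE /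
        (CoeffList.eval u cN1 * ((CoeffList.eval u cP1 - s) / (2 * CoeffList.eval u cQ)) + CoeffList.eval u cN0)
      = 4 + 2 * u := by
  have h := CoeffList₂.eval_eq_zero_of_isZero u s _ trace_row2_cert
  simp only [cWp, cWm, cMp, cMm, cXp, cXm, cD, CoeffList₂.eval_sub, CoeffList₂.eval_add,
    CoeffList₂.eval_smul, CoeffList₂.eval_mul, CoeffList₂.eval_cons, CoeffList₂.eval_nil,
    CoeffList.eval_sub, CoeffList.eval_mul, CoeffList.eval_smul, CoeffList.eval_neg,
    CoeffList.eval_cons, CoeffList.eval_nil, mul_zero, add_zero, zero_add] at h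
  push_cast at h
  set Q := CoeffList.eval u cQ with hQdef
  set P1 := CoeffList.eval u cP1
  set P2 := CoeffList.eval u cP2
  set D1 := CoeffList.eval u cD1
  set D2 := CoeffList.eval u cD2
  set E := CoeffList.eval u cE
  set N1 := CoeffList.eval u cN1
  set N0 := CoeffList.eval u cN0
  set K := CoeffList₂.eval u s cK2
  have hD : -(P1 * P1 - 4 * (Q * P2)) + s * (s * 1) = 0 := by linear_combination hs
  rw [hD, mul_zero, sub_zero] at h
  have h2Q : (2 : ℝ) * Q ≠ 0 := mul_ne_zero two_ne_zero hQ
  have hMp' : N1 * (P1 + s) + 2 * Q * N0 ≠ 0 := by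
    intro h0; apply hMp
    rw [show N1 * ((P1 + s) / (2 * Q)) + N0 = (N1 * (P1 + s) + 2 * Q * N0) / (2 * Q) by
      field_simp]
    rw [h0, zero_div]
  have hMm' : N1 * (P1 - s) + 2 * Q * N0 ≠ 0 := by
    intro h0; apply hMm
    rw [show N1 * ((P1 - s) / (2 * Q)) + N0 = (N1 * (P1 - s) + 2 * Q * N0) / (2 * Q) by
      field_simp]
    rw [h0, zero_div]
  have hQs : Q * s ≠ 0 := mul_ne_zero hQ hs0
  have hden : (2 : ℝ) * Q ^ 2 * s ≠ 0 := by positivity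
  have e1 : (P1 + s) / (2 * Q) * (((P1 + s) / (2 * Q) * D1 - D2) / (Q * s)) * E /
        (N1 * ((P1 + s) / (2 * Q)) + N0) =
      (P1 + s) * (D1 * (P1 + s) - 2 * Q * D2) * E / (2 * Q ^ 2 * s * (N1 * (P1 + s) + 2 * Q * N0)) := by
    rw [div_eq_div_iff hMp (mul_ne_zero hden hMp')]
    field_simp
  have e2 : (P1 - s) / (2 * Q) * (((P1 - s) / (2 * Q) * D1 - D2) / (-(Q * s))) * E /
        (N1 * ((P1 - s) / (2 * Q)) + N0) =
      -((P1 - s) * (D1 * (P1 - s) - 2 * Q * D2) * E) / (2 * Q ^ 2 * s * (N1 * (P1 - s) + 2 * Q * N0)) := by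
    rw [div_eq_div_iff hMm (mul_ne_zero hden hMm')]
    field_simp
  rw [e1, e2, div_add_div _ _ (mul_ne_zero hden hMp') (mul_ne_zero hden hMm'),
    div_eq_iff (mul_ne_zero (mul_ne_zero hden hMp') (mul_ne_zero hden hMm'))]
  linear_combination (2 * Q ^ 2 * s) * h

/-- `E = Q² (u² + 4)` coefficientwise (in the scalings of the data file). [folklore] -/
theorem cE_cert : CoeffList.isZero (CoeffList.sub cE (CoeffList.mul (CoeffList.mul cQ cQ) [4, 0, 1])) = true := by
  decide +kernel

/-- `E(u) = Q(u)² (u² + 4)`; in particular `E > 0` wherever `Q ≠ 0`. [folklore] -/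
theorem eval_cE (u : ℝ) : CoeffList.eval u cE = CoeffList.eval u cQ ^ 2 * (u ^ 2 + 4) := by
  have h := CoeffList.eval_eq_of_isZero_sub u _ _ cE_cert
  rw [h, CoeffList.eval_mul, CoeffList.eval_mul]
  simp [CoeffList.eval_cons]
  ring

/-- The discriminant list evaluates to `P₁² − 4 Q P₂`. [folklore] -/
theorem eval_cD (u : ℝ) :
    CoeffList.eval u cD = CoeffList.eval u cP1 ^ 2 - 4 * CoeffList.eval u cQ * CoeffList.eval u cP2 := by
  simp [cD]
  ring

/-- `D₁ = P₁' Q − P₁ Q'` with the derivatives given by `CoeffList.derivList`. [folklore] -/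
theorem eval_cD1 (u : ℝ) :
    CoeffList.eval u cD1 = CoeffList.eval u (CoeffList.derivList cP1) * CoeffList.eval u cQ -
      CoeffList.eval u cP1 * CoeffList.eval u (CoeffList.derivList cQ) := by
  simp [cD1]

/-- `D₂ = P₂' Q − P₂ Q'` with the derivatives given by `CoeffList.derivList`. [folklore] -/
theorem eval_cD2 (u : ℝ) :
    CoeffList.eval u cD2 = CoeffList.eval u (CoeffList.derivList cP2) * CoeffList.eval u cQ -
      CoeffList.eval u cP2 * CoeffList.eval u (CoeffList.derivList cQ) := by
  simp [cD2]

/-- The derivative list of the discriminant: `disc' = 2P₁P₁' − 4(Q'P₂ + QP₂')` coefficientwise. [folklore] -/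
theorem derivList_cD_cert : CoeffList.isZero (CoeffList.sub (CoeffList.derivList cD)
    (CoeffList.sub (CoeffList.smul 2 (CoeffList.mul cP1 (CoeffList.derivList cP1)))
      (CoeffList.smul 4 (CoeffList.add (CoeffList.mul (CoeffList.derivList cQ) cP2)
        (CoeffList.mul cQ (CoeffList.derivList cP2)))))) = true := by
  decide +kernel

/-- `disc'(u) = 2P₁P₁' − 4(Q'P₂ + QP₂')`. [folklore] -/
theorem eval_derivList_cD (u : ℝ) : CoeffList.eval u (CoeffList.derivList cD) =
    2 * (CoeffList.eval u cP1 * CoeffList.eval u (CoeffList.derivList cP1)) -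
      4 * (CoeffList.eval u (CoeffList.derivList cQ) * CoeffList.eval u cP2 +
        CoeffList.eval u cQ * CoeffList.eval u (CoeffList.derivList cP2)) := by
  have h := CoeffList.eval_eq_of_isZero_sub u _ _ derivList_cD_cert
  rw [h]
  simp only [CoeffList.eval_sub, CoeffList.eval_smul, CoeffList.eval_add, CoeffList.eval_mul]
  push_cast
  ring

/-- `Q − 36 u¹⁸ > 0` on `(−∞, −1]`: a lower bound of the correct order at `−∞`
(certificate after `u = −1 − t`). [folklore] -/
theorem Q_sub_lead_pos {u : ℝ} (hu : u ≤ -1) :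
    0 < CoeffList.eval u (CoeffList.add cQ [0,0,0,0,0,0,0,0,0,0,0,0,0,0,0,0,0,0,-36]) :=
  CoeffList.eval_pos_of_le (p := CoeffList.add cQ [0,0,0,0,0,0,0,0,0,0,0,0,0,0,0,0,0,0,-36]) (a := -1)
    (c := (CoeffList.comp (CoeffList.add cQ [0,0,0,0,0,0,0,0,0,0,0,0,0,0,0,0,0,0,-36]) [-1, -1]).headD 0)
    (q := (CoeffList.comp (CoeffList.add cQ [0,0,0,0,0,0,0,0,0,0,0,0,0,0,0,0,0,0,-36]) [-1, -1]).tail)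
    (by decide +kernel) (by decide +kernel) (by decide +kernel) (by exact_mod_cast hu)

/-- Values at `u = −1`: `Q(−1) = 148237740`, `P₁(−1) = −65883440` (`= −(4/9)·148237740`),
`P₂(−1) = 0`, as integer evaluations. [folklore] -/
theorem eval_neg_one_int :
    CoeffList.eval (-1 : ℤ) cQ = 148237740 ∧ CoeffList.eval (-1 : ℤ) cP1 = -65883440 ∧
      CoeffList.eval (-1 : ℤ) cP2 = 0 := by
  refine ⟨?_, ?_, ?_⟩ <;> decide +kernel

/-- Integer evaluation agrees with real evaluation at integer points. [folklore] -/
theorem eval_intCast (z : ℤ) : ∀ p : List ℤ, ((CoeffList.eval z p : ℤ) : ℝ) = CoeffList.eval (z : ℝ) p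
  | [] => by simp
  | a :: p => by
      rw [CoeffList.eval_cons, CoeffList.eval_cons, ← eval_intCast z p]
      push_cast
      ring

/-- Values at `u = −1` over `ℝ`. [folklore] -/
theorem eval_neg_one :
    CoeffList.eval (-1 : ℝ) cQ = 148237740 ∧ CoeffList.eval (-1 : ℝ) cP1 = -65883440 ∧
      CoeffList.eval (-1 : ℝ) cP2 = 0 := by
  obtain ⟨h1, h2, h3⟩ := eval_neg_one_int
  refine ⟨?_, ?_, ?_⟩
  · have := eval_intCast (-1) cQ; rw [h1] at this; push_cast at this; linarith
  · have := eval_intCast (-1) cP1; rw [h2] at this; push_cast at this; linarith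
  · have := eval_intCast (-1) cP2; rw [h3] at this; push_cast at this; linarith

end Summit.KontsevichZagierPeriods.IsogenyCertificates.JLPair
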